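import Literature.AlgebraicGeometry.Resolution.WeightedCentreFaceImage
import Literature.AlgebraicGeometry.Resolution.WeightedCentreTruncation
import HarnessLib

/-!
# Weighted centres — the tower storey `ρ₁^Z` lands in the GRADED face isotropies (weights `w ∘ Subtype.val`)

Instrument for engine 1's `W(f)` TOY MODEL (cell `pub-rosobs`, LF-MODEL-eng1-g45 §6.2 REDUCTION; the last membership of CARVER-NOTES-eng1-g47 §2 (d): the image of `ρ₁` is
GRADED for the face weights `w_Z := w ∘ Subtype.val`), NOT a resolution theorem and NOT about the invariant of [AbramovichTemkinWlodarczyk2024].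

Bookkeeping chain: `killLight (· ∉ Z) = rename Subtype.val ∘ killCompl` (the same-ring face is the honest face re-embedded), hence `killCompl` preserves weighted homogeneity
(`isWeightedHomogeneous_killCompl`, via `IsWeightedHomogeneous.killLight` and injectivity of `rename Subtype.val`); `faceRingEquiv Z ∘ mk = Polynomial.map killCompl`
(`faceRingEquiv_mk`), hence total weight is preserved (`isTW_faceRingEquiv_mk`); so `restrictFace A` is a graded endomorphism (`isGradedHom_restrictFace`) and, with non-negative weights,
lies in `graded (w ∘ Subtype.val) 1` (`restrictFace_mem_graded`, inverse by `LevelProjection.isGradedHom_symm`).  Packaged: `restrictFace_mem_faceIso` — `ρ₁^Z A ∈ graded ⊓ baseFixing ⊓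
𝔄_1 ⊓ fixSlots V_Z ⊓ Stab (C g_Z)` (everything of `isoFix w_Z Z₂ V_Z g_Z` except `fixSlots Z₂`, which is THEOREM A⁺ on the face).

References: [Lang2002, Ch. I §3, Ch. II §1, Ch. IV §1, Ch. XIII §4]; [AbramovichTemkinWlodarczyk2024, §5.1 (p. 1575), Thm. 5.3.1 (2)–(3) (p. 1578)].
-/

namespace Literature.AlgebraicGeometry.Resolution.WeightedBlowup.ZKernel

open Polynomial OrderFiltration LevelProjection

variable {k : Type*} [CommRing k] {ι : Type*}

/-- **Same-ring face = honest face re-embedded**: `killLight (· ∉ Z) = rename Subtype.val ∘ killCompl` (CARVER-NOTES-eng1-g47 §2 (c); bookkeeping).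
[cite: AbramovichTemkinWlodarczyk2024, §5.1 (p. 1575)] -/
theorem killLight_eq_rename_killCompl (Z : Set ι) [DecidablePred (· ∈ Z)] (P : MvPolynomial ι k) :
    killLight (fun j => j ∉ Z) P =
      MvPolynomial.rename Subtype.val (_root_.MvPolynomial.killCompl (Subtype.val_injective (p := fun j : ι => j ∉ Z)) P) := by
  rw [← AlgHom.comp_apply]
  refine DFunLike.congr_fun (MvPolynomial.algHom_ext fun j => ?_) P
  rw [killLight_X, heavyX, AlgHom.comp_apply]
  by_cases hj : j ∈ Z
  · have hr : j ∉ Set.range (Subtype.val : {j : ι // j ∉ Z} → ι) := by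
      rintro ⟨a, ha⟩
      exact a.2 (ha ▸ hj)
    rw [if_neg (not_not.mpr hj), Literature.AlgebraicGeometry.Resolution.MvPolynomial.killCompl_X_of_not_mem_range _ hr, map_zero]
  · rw [if_pos hj, show (MvPolynomial.X j : MvPolynomial ι k) = MvPolynomial.X ((⟨j, hj⟩ : {j : ι // j ∉ Z}).val) from rfl,
      Literature.AlgebraicGeometry.Resolution.MvPolynomial.killCompl_X_apply, MvPolynomial.rename_X]

/-- Weighted homogeneity descends along the injective renaming `rename Subtype.val` (bookkeeping). [cite: Lang2002, Ch. IV §1] -/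
theorem isWeightedHomogeneous_of_rename_val {M : Type*} [AddCommMonoid M] {w : ι → M} {Z : Set ι} {Q : MvPolynomial {j : ι // j ∉ Z} k} {m : M}
    (h : MvPolynomial.IsWeightedHomogeneous w (MvPolynomial.rename Subtype.val Q) m) : MvPolynomial.IsWeightedHomogeneous (w ∘ Subtype.val) Q m := by
  intro d hd
  have hc : MvPolynomial.coeff (d.mapDomain Subtype.val) (MvPolynomial.rename Subtype.val Q) = MvPolynomial.coeff d Q :=
    MvPolynomial.coeff_rename_mapDomain _ Subtype.val_injective Q d
  have hw := h (show MvPolynomial.coeff (d.mapDomain Subtype.val) (MvPolynomial.rename Subtype.val Q) ≠ 0 by rwa [hc])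
  have hmap : Finsupp.weight w (d.mapDomain Subtype.val) = Finsupp.weight (w ∘ Subtype.val) d := by
    simp only [Finsupp.weight_apply]
    exact Finsupp.sum_mapDomain_index (fun _ => zero_smul ℕ _) (fun _ _ _ => add_smul _ _ _)
  rwa [hmap] at hw

/-- **Killing the `Z`-variables preserves weighted homogeneity** (face weights `w ∘ Subtype.val`; bookkeeping). [cite: Lang2002, Ch. IV §1; AbramovichTemkinWlodarczyk2024, §5.1 (p. 1575)] -/
theorem isWeightedHomogeneous_killCompl {M : Type*} [AddCommMonoid M] {w : ι → M} (Z : Set ι) {P : MvPolynomial ι k} {m : M}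
    (hP : MvPolynomial.IsWeightedHomogeneous w P m) :
    MvPolynomial.IsWeightedHomogeneous (w ∘ Subtype.val) (_root_.MvPolynomial.killCompl (Subtype.val_injective (p := fun j : ι => j ∉ Z)) P) m := by
  classical
  refine isWeightedHomogeneous_of_rename_val ?_
  rw [← killLight_eq_rename_killCompl]
  exact hP.killLight _

/-- **`faceRingEquiv Z ∘ mk = Polynomial.map killCompl`** (bookkeeping). [cite: Lang2002, Ch. II §1, Ch. IV §1] -/
theorem faceRingEquiv_mk (Z : Set ι) (F : (MvPolynomial ι k)[X]) :
    faceRingEquiv Z (Ideal.Quotient.mk (slotIdeal Z) F) =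
      Polynomial.map (_root_.MvPolynomial.killCompl (Subtype.val_injective (p := fun j : ι => j ∉ Z)) : MvPolynomial ι k →ₐ[k] MvPolynomial {j : ι // j ∉ Z} k).toRingHom F := by
  have h := Polynomial.ringHom_ext (f := (faceRingEquiv (k := k) Z).toRingHom.comp (Ideal.Quotient.mk (slotIdeal (k := k) Z)))
    (g := Polynomial.mapRingHom (_root_.MvPolynomial.killCompl (Subtype.val_injective (p := fun j : ι => j ∉ Z)) :
      MvPolynomial ι k →ₐ[k] MvPolynomial {j : ι // j ∉ Z} k).toRingHom)
    (fun a => by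
      rw [RingHom.comp_apply, Polynomial.coe_mapRingHom, Polynomial.map_C]
      exact faceRingEquiv_mk_C Z a)
    (by
      rw [RingHom.comp_apply, Polynomial.coe_mapRingHom, Polynomial.map_X]
      exact faceRingEquiv_mk_X Z)
  exact RingHom.congr_fun h F

/-- **The face map preserves total weight** (face weights `w ∘ Subtype.val`, `deg σ = ρ`; bookkeeping). [cite: AbramovichTemkinWlodarczyk2024, Thm. 5.3.1 (2)–(3) (p. 1578)] -/
theorem isTW_faceRingEquiv_mk {M : Type*} [AddCommGroup M] {w : ι → M} {ρ m : M} (Z : Set ι) {F : (MvPolynomial ι k)[X]} (hF : IsTW w ρ m F) :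
    IsTW (w ∘ Subtype.val) ρ m (faceRingEquiv Z (Ideal.Quotient.mk (slotIdeal Z) F)) := fun s => by
  rw [faceRingEquiv_mk, Polynomial.coeff_map]
  exact isWeightedHomogeneous_killCompl Z (hF s)

variable {w : ι → ℚ} {Z V : Set ι} {g : MvPolynomial ι k}

/-- **`ρ₁^Z A` is a graded endomorphism of the face ring** (weights `w ∘ Subtype.val`, `deg σ = 1`). [cite: AbramovichTemkinWlodarczyk2024, Thm. 5.3.1 (2)–(3) (p. 1578); Lang2002, Ch. IV §1] -/
theorem isGradedHom_restrictFace (A : isoFix w Z V g) :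
    IsGradedHom (w ∘ Subtype.val) (1 : ℚ)
      (restrictFace w Z V g A : (MvPolynomial {j : ι // j ∉ Z} k)[X] →+* (MvPolynomial {j : ι // j ∉ Z} k)[X]) where
  map_C_C c := by
    rw [RingEquiv.coe_toRingHom]
    exact restrictFace_C_C A c
  isTW_X := by
    rw [RingEquiv.coe_toRingHom, restrictFace_X]
    exact isTW_X
  isTW_CX j := by
    rw [RingEquiv.coe_toRingHom, restrictFace_C_X]
    exact isTW_faceRingEquiv_mk Z (A.2.1.1.1.1.1.1.isTW_CX j.1)

/-- **`ρ₁^Z A ∈ graded (w ∘ Subtype.val) 1`** (non-negative weights; inverse graded by `LevelProjection.isGradedHom_symm`). [cite: Lang2002, Ch. IV §1, Ch. XIII §4;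
AbramovichTemkinWlodarczyk2024, Thm. 5.3.1 (2)–(3) (p. 1578)] -/
theorem restrictFace_mem_graded (hw : ∀ i, 0 ≤ w i) (A : isoFix w Z V g) :
    restrictFace w Z V g A ∈ graded (k := k) (w ∘ Subtype.val : {j : ι // j ∉ Z} → ℚ) (1 : ℚ) := by
  refine ⟨isGradedHom_restrictFace A, isGradedHom_symm (isGradedHom_restrictFace A) (restrictFace_X A) (fun j => ?_) (fun j => hw j.1) one_pos⟩
  obtain ⟨z, hz⟩ := (restrictFace_mem_level_one A).2 (C (MvPolynomial.X j))
  exact ⟨z, by rw [hz, pow_one, add_sub_cancel_left]⟩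

/-- **THE IMAGE OF THE TOWER STOREY** (LF-MODEL-eng1-g45 §6.2 REDUCTION; CARVER-NOTES-eng1-g47 §2 (d), all five memberships): for `A ∈ isoFix w Z V g`,
`ρ₁^Z A ∈ graded (w ∘ val) 1 ⊓ baseFixing ⊓ 𝔄_1 ⊓ fixSlots (val ⁻¹' V) ⊓ Stab (C (killCompl g))` — a graded `k[σ]`-isotropy `≡ id (mod σ)` of the honest face, fixing `ε_{V ∖ Z}`.
(Membership in `fixSlots Z₂` for the next light class — i.e. `∈ isoFix (w ∘ val) Z₂ (val ⁻¹' V) (killCompl g)` — is THEOREM A⁺ on the face.)  Instrument for engine 1's `W(f)` toy model,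
NOT a resolution theorem. [cite: Lang2002, Ch. I §3, Ch. II §1, Ch. IV §1; AbramovichTemkinWlodarczyk2024, §5.1 (p. 1575), Thm. 5.3.1 (2)–(3) (p. 1578)] -/
theorem restrictFace_mem_faceIso (hw : ∀ i, 0 ≤ w i) (A : isoFix w Z V g) :
    restrictFace w Z V g A ∈
      graded (k := k) (w ∘ Subtype.val : {j : ι // j ∉ Z} → ℚ) (1 : ℚ) ⊓ baseFixing ⊓ level (X : (MvPolynomial {j : ι // j ∉ Z} k)[X]) 1 ⊓
        fixSlots (Subtype.val ⁻¹' V : Set {j : ι // j ∉ Z}) ⊓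
        MulAction.stabilizer ((MvPolynomial {j : ι // j ∉ Z} k)[X] ≃+* (MvPolynomial {j : ι // j ∉ Z} k)[X])
          (C (_root_.MvPolynomial.killCompl (Subtype.val_injective (p := fun j : ι => j ∉ Z)) g) : (MvPolynomial {j : ι // j ∉ Z} k)[X]) :=
  ⟨⟨⟨⟨restrictFace_mem_graded hw A, restrictFace_mem_baseFixing A⟩, restrictFace_mem_level_one A⟩, restrictFace_mem_fixSlots A⟩,
    restrictFace_mem_stabilizer A⟩

end Literature.AlgebraicGeometry.Resolution.WeightedBlowup.ZKernel
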